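import Summits.BirchSwinnertonDyer.Rank1Residual.Additive.GoodSupersingularPadicModel
import Summits.BirchSwinnertonDyer.Rank1Residual.Additive.StrictSelmerIndex
import Summits.BirchSwinnertonDyer.Rank1Residual.Additive.QuadraticBranchOddStrictSelmerLevel
import HarnessLib

/-!
# The odd `η`-branch consumers WITHOUT the hypothesis "`W(ℚ_p)` has no point of order `p`"
# (cell `b2b-bsdres`, CLASS-CLOSURE lane, class O10 — x1b GEN 32, class lead; file 9 of the local
# series p315764 / p316085 / p316474 / p316672 / p317003)

HONEST FRAMING (cell `b2b-bsdres`, run/shared/lean/b2b/bsd-rank1-residual/, verbatim in every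
file): the goal of the cell is to DELETE the COMBINATION-SHAPED residual classes of the
Birch–Swinnerton-Dyer formula for ALL analytic-rank `≤ 1` elliptic curves over `ℚ` — "full BSD
formula for every rank `≤ 1` curve in class `C`" assembled STRICTLY from published theorems — so
that the rank-`≤ 1` remainder becomes exactly the CONSTRUCTION-SHAPED classes, which are TYPED
(missing-input `Prop`s), NOT attempted. This is not "finishing BSD". CLASS-CLOSURE lane: prove
what is provable now; shrink each hard class to its core with data; no claim beyond stated classes;
research routes on CONSTRUCTION-SHAPED X12 / O10; census / instrument output = EVIDENCE / conjecture
items, NEVER a Literature fact; `RESIDUAL-MAP.md` marks change only by signed lines. THIS FILE: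
RE-EXPORTS ONLY (one-line applications of landed consumers with their `htors` hypothesis supplied by
file 8's `eq_zero_of_prime_smul_eq_zero_padic_of_quadraticTwist_goodSupersingular`) — no
definition, no named Literature fact, no Summits-side fact `def`, no `sorry`, axioms standard;
CONDITIONAL on the same typed inputs as the originals ((C1_η) `QuadraticBranchPlusMainConjectureAt`,
(C2_η-GZ) `QuadraticBranchMinusLeadingValuationAt W p 0`, (C3_η)
`QuadraticBranchOddStrictExactControlOfPlusMCAt`, resp. the Kato-direction bound
`QuadraticBranchOddStrictSelmerBoundOfPlusMCAt`) and on the named facts they take (modularity,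
Gross–Zagier I.(7.3), GZK); nothing is booked; no label / mark / count / sub-cell moves; O10 stays
OPEN / CONSTRUCTION-SHAPED; nothing about `BSD(W, p)` of any pair is claimed unconditionally.

## What is re-exported (the hypothesis `∀ Q : (W.baseChange ℚ_[p]).toAffine.Point, p • Q = 0 → Q = 0` REMOVED)

* `exists_card_strictSelmerPInfty_eq_pow_mul_of_quadraticTwist` — x1b GEN 30's hypothesis-light
  index theorem (`StrictSha.exists_card_strictSelmerPInfty_eq_pow_mul`, p310832): for the
  `p*`-partner `W` (Mordell–Weil rank one) of a globally minimal good supersingular `V`, `p ≠ 2`: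
  `∃ n, #Sel_str(W/ℚ)[p^∞] = pⁿ · #Ш(W/ℚ)[p^∞]` — now with NO local hypothesis at all.
* `bsdp_of_quadraticBranchPAdicGrossZagierValuation_of_exactControl_model`,
  `pPart_of_quadraticBranchPAdicGrossZagierValuation_of_exactControl_model` — x1b GEN 30's
  `…_of_exactControl_index` (themselves cc-typer-6's p307042 §4 without the index input) WITHOUT
  `htors`: **(C1_η) ∧ (C2_η-GZ) ∧ (C3_η) ⟹ `BSD(W, p)`, `PPart W p`, `MissingPPartAt W p`** with the
  generator / level data as the only non-typed inputs.
* `not_p_divisible_of_oddStrictSelmerBoundOfPlusMC_of_unit_model` — cc-typer-6 / x1b GEN 30's unit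
  certificate consumer (`QuadraticBranchOddStrictSelmerLevel`, p311711): typed Kato-direction bound
  + `IsUnit(coeff₁ L⁻_η)` ⟹ the generator is not `p`-divisible in `W(ℚ_p)` and `Ш(W)[p^∞] = 0`,
  WITHOUT `htors`.

References: [SerreInventiones1972] §1.11 Prop. 12; [Kobayashi2003] Prop. 8.7, §4, Thm. 7.4,
Thm. 9.3; [GreenbergLNM1716] §2; [Miller2011LMS] §1.
-/

noncomputable section

open scoped Classical MatrixGroups ModularForm

namespace Summit.BirchSwinnertonDyer.Rank1Residual.Additive

open CongruenceSubgroup WeierstrassCurve Literature.NumberTheory.EllipticCurves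
  Literature.NumberTheory.EllipticCurves.ModularForms
  Literature.NumberTheory.EllipticCurves.Kobayashi2003
  Literature.NumberTheory.EllipticCurves.Rank1Residual
  Literature.NumberTheory.EllipticCurves.Rank1Residual.Typed

section Consumers

variable (W : WeierstrassCurve ℚ) [W.IsElliptic] [W.IsGloballyMinimal] (p : ℕ) [hp : Fact p.Prime]
  {V : WeierstrassCurve ℚ} [V.IsElliptic] [V.IsGloballyMinimal] {C : VariableChange ℚ}
  {N : ℕ} [NeZero N] {f : CuspForm (Gamma0 N) 2} {ϖ : ℚ} {L : IwasawaAlgebra p}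
  {P : W.toAffine.Point} {n : ℕ}

omit [W.IsGloballyMinimal] in
/-- **`#Sel_str(W/ℚ)[p^∞] = pⁿ · #Ш(W/ℚ)[p^∞]` for the `p*`-partner of a good supersingular curve,
with NO local hypothesis**: `W` of Mordell–Weil rank one, `C • W.quadraticTwist (p*) = V`, `V`
globally minimal with good reduction at `p ≠ 2` and `a_p(V) = 0` (x1b GEN 30's
`StrictSha.exists_card_strictSelmerPInfty_eq_pow_mul` + file 8).
[cite: GreenbergLNM1716, §2 (pp. 62–63)] [cite: SerreInventiones1972, §1.11 Prop. 12] -/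
theorem exists_card_strictSelmerPInfty_eq_pow_mul_of_quadraticTwist (hp2 : p ≠ 2)
    (hrank : W.mordellWeilRank = 1) (hC : C • W.quadraticTwist ((-1) ^ (p / 2) * p) = V)
    (hgood : V.HasGoodReductionAtPrime p) (hap : V.frobeniusTrace p = 0) :
    ∃ n : ℕ, Nat.card ↥(strictSelmerPInfty W p) =
      p ^ n * Nat.card (AddCommGroup.primaryComponent W.sha p) :=
  StrictSha.exists_card_strictSelmerPInfty_eq_pow_mul W p hrank
    (eq_zero_of_prime_smul_eq_zero_padic_of_quadraticTwist_goodSupersingular hp2 W C V hC hgood hap)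

/-- **(C1_η) ∧ (C2_η-GZ) ∧ (C3_η) ⟹ `BSD(W, p)` WITHOUT the hypothesis "`W(ℚ_p)[p] = 0`"** (x1b GEN
30's `bsdp_of_quadraticBranchPAdicGrossZagierValuation_of_exactControl_index` with `htors` supplied
by file 8; `5 ≤ p`). CONDITIONAL on the three typed inputs and the named facts `hmod`, `hGZ`,
`hGZK`; nothing booked. [cite: Miller2011LMS, §1 and Def. 1.1]
[cite: Kobayashi2003, §4 (p. 8), Thm. 7.4 (p. 13), Thm. 9.3 (p. 26)] -/
theorem bsdp_of_quadraticBranchPAdicGrossZagierValuation_of_exactControl_model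
    (hmod : hasEntireLFunction_rat) (hGZ : GrossZagier1986_thm_I_7_3)
    (hGZK : rank_eq_analyticRank_of_analyticRank_le_one)
    (h2 : QuadraticBranchMinusLeadingValuationAt W p 0)
    (h3 : QuadraticBranchOddStrictExactControlOfPlusMCAt W p)
    (hp5 : 5 ≤ p) (hC : C • W.quadraticTwist ((-1) ^ (p / 2) * p) = V)
    (hgood : V.HasGoodReductionAtPrime p) (hap : V.frobeniusTrace p = 0)
    (h1 : QuadraticBranchPlusMainConjectureAt V p) (hf : IsNewformOf V f)
    (hϖ : if Even (p / 2) then (ϖ : ℝ) * V.realPeriodRat = plusPeriod f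
        else (ϖ : ℝ) * V.imaginaryPeriodRat = minusPeriod f)
    (hL : IsQuadraticBranchMinusLFunction f p ϖ L)
    (hP : ¬ IsOfFinAddOrder P)
    (hgen : ∀ R : W.toAffine.Point, ∃ (k : ℤ) (T : W.toAffine.Point),
      IsOfFinAddOrder T ∧ R = k • P + T)
    (hdiv : ∃ Q : (W.baseChange ℚ_[p]).toAffine.Point, p ^ n • Q = W.toPadicPoint p P)
    (hndiv : ∀ Q : (W.baseChange ℚ_[p]).toAffine.Point, p ^ (n + 1) • Q ≠ W.toPadicPoint p P)
    (hr : W.analyticRank = 1) : BSDp W p :=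
  bsdp_of_quadraticBranchPAdicGrossZagierValuation_of_exactControl_index W p hmod hGZ hGZK h2 h3 hp5
    hC hgood hap h1 hf hϖ hL
    (eq_zero_of_prime_smul_eq_zero_padic_of_quadraticTwist_goodSupersingular (by omega) W C V hC
      hgood hap)
    hP hgen hdiv hndiv hr

/-- … hence **`PPart W p ∧ MissingPPartAt W p` WITHOUT "`W(ℚ_p)[p] = 0`"** (x1b GEN 30's
`pPart_of_quadraticBranchPAdicGrossZagierValuation_of_exactControl_index` + file 8). CONDITIONAL on
the typed inputs; nothing booked. [cite: Miller2011LMS, §1 and Def. 1.1] [cite: GreenbergLNM1716, §2 (pp. 62–63)] -/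
theorem pPart_of_quadraticBranchPAdicGrossZagierValuation_of_exactControl_model
    (hmod : hasEntireLFunction_rat) (hGZ : GrossZagier1986_thm_I_7_3)
    (hGZK : rank_eq_analyticRank_of_analyticRank_le_one)
    (h2 : QuadraticBranchMinusLeadingValuationAt W p 0)
    (h3 : QuadraticBranchOddStrictExactControlOfPlusMCAt W p)
    (hp5 : 5 ≤ p) (hC : C • W.quadraticTwist ((-1) ^ (p / 2) * p) = V)
    (hgood : V.HasGoodReductionAtPrime p) (hap : V.frobeniusTrace p = 0)
    (h1 : QuadraticBranchPlusMainConjectureAt V p) (hf : IsNewformOf V f)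
    (hϖ : if Even (p / 2) then (ϖ : ℝ) * V.realPeriodRat = plusPeriod f
        else (ϖ : ℝ) * V.imaginaryPeriodRat = minusPeriod f)
    (hL : IsQuadraticBranchMinusLFunction f p ϖ L)
    (hP : ¬ IsOfFinAddOrder P)
    (hgen : ∀ R : W.toAffine.Point, ∃ (k : ℤ) (T : W.toAffine.Point),
      IsOfFinAddOrder T ∧ R = k • P + T)
    (hdiv : ∃ Q : (W.baseChange ℚ_[p]).toAffine.Point, p ^ n • Q = W.toPadicPoint p P)
    (hndiv : ∀ Q : (W.baseChange ℚ_[p]).toAffine.Point, p ^ (n + 1) • Q ≠ W.toPadicPoint p P)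
    (hr : W.analyticRank = 1) : Rank1Residual.PPart W p ∧ MissingPPartAt W p :=
  pPart_of_quadraticBranchPAdicGrossZagierValuation_of_exactControl_index W p hmod hGZ hGZK h2 h3 hp5
    hC hgood hap h1 hf hϖ hL
    (eq_zero_of_prime_smul_eq_zero_padic_of_quadraticTwist_goodSupersingular (by omega) W C V hC
      hgood hap)
    hP hgen hdiv hndiv hr

/-- **The unit certificate WITHOUT "`W(ℚ_p)[p] = 0`"**: given the typed Kato-direction bound
`QuadraticBranchOddStrictSelmerBoundOfPlusMCAt W p`, (C1_η) for `V`, an odd-branch function `Lη`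
with `IsUnit (coeff₁ Lη)`, and a generator `P` of `W(ℚ)` modulo torsion: `P` is NOT `p`-divisible in
`W(ℚ_p)` and `Ш(W)[p^∞] = 0` (x1b GEN 30's `not_p_divisible_of_oddStrictSelmerBoundOfPlusMC_of_unit`,
p311711, + file 8). CONDITIONAL on the typed bound and (C1_η); nothing booked.
[cite: Kobayashi2003, Thm. 4.1 (p. 8) and Lemma 9.1 (p. 25)] [cite: GreenbergLNM1716, §2 (pp. 62–63)] -/
theorem not_p_divisible_of_oddStrictSelmerBoundOfPlusMC_of_unit_model
    (h : QuadraticBranchOddStrictSelmerBoundOfPlusMCAt W p) {Lη : IwasawaAlgebra p}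
    (hp2 : p ≠ 2) (hC : C • W.quadraticTwist ((-1) ^ (p / 2) * p) = V)
    (hgood : V.HasGoodReductionAtPrime p) (hap : V.frobeniusTrace p = 0)
    (h1 : QuadraticBranchPlusMainConjectureAt V p) (hf : IsNewformOf V f)
    (hϖ : if Even (p / 2) then (ϖ : ℝ) * V.realPeriodRat = plusPeriod f
        else (ϖ : ℝ) * V.imaginaryPeriodRat = minusPeriod f)
    (hL : IsQuadraticBranchMinusLFunction f p ϖ Lη) (hunit : IsUnit (PowerSeries.coeff 1 Lη))
    (hP : ¬ IsOfFinAddOrder P)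
    (hgen : ∀ R : W.toAffine.Point, ∃ (k : ℤ) (T : W.toAffine.Point),
      IsOfFinAddOrder T ∧ R = k • P + T) :
    (∀ Q : (W.baseChange ℚ_[p]).toAffine.Point, p • Q ≠ W.toPadicPoint p P) ∧
      Nat.card (AddCommGroup.primaryComponent W.sha p) = 1 :=
  not_p_divisible_of_oddStrictSelmerBoundOfPlusMC_of_unit W p h hp2 hC hgood hap h1 hf hϖ hL hunit
    (eq_zero_of_prime_smul_eq_zero_padic_of_quadraticTwist_goodSupersingular hp2 W C V hC hgood hap)
    hP hgen

end Consumers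

end Summit.BirchSwinnertonDyer.Rank1Residual.Additive

end
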